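import Summits.BirchSwinnertonDyer.BirchSwinnertonDyer.Theorems.ErratumRoadFiveNonSurjCornerModPImageCoprime
import HarnessLib

/-!
# Route `ErratumRoadFive` (rung K2), crux `NonSurjCorner` (item stmt-BirchSwinnertonDyer-19065), line `Lines/hybrid.lean`, r22 slot 6″:
# the Chebotarev–Kummer AUXILIARY-PRIME SUPPLY at a non-surjective irreducible image, MODULO THE FROBENIUS PRE-WITNESS (L1) only
# (cell `bsd-stepL`, seat `bsd-stepL-corner-p1` g18; `--supports stmt-BirchSwinnertonDyer-19065 --as helper`)

WHY THIS FILE. r22's slot 6″ asks `AuxNormReceptacle.AuxiliaryPrimeSupply W K p q N` on the corner frames; -w2 g5 proved it under `Surj` using the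
surjective image in two callees — the pre-witness (L1) and the Kummer exclusion (L2). (L2) is now a corner theorem
(`…NonSurjCornerModPImageCoprime`, `…NonSurjCornerAuxPrimeKummerDescent`); this file re-runs -w2 g5's proof VERBATIM with (L2) discharged and (L1)
as the ONLY hypothesis. Hence the (B6)-free Euler half of 19065 (road B, `…HybridRoadB`) hinges on ONE Galois statement per corner pair and level:
the existence of `γ ∈ Γ_ℚ ∖ Γ_K` inverting `ζ_{p^E}` with `tr ρ̄_{E,p}(γ) ≢ 0 (mod p)`.
* `AuxPrimeSupplyCorner.auxiliaryPrimeSupply_of_preWitness`.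

HONEST FRAMING: ONE THEOREM (no definition, no named fact, no `sorry`); CONDITIONAL on `hpre`; nothing about any curve's BSD; 19065 NOT closed; BSD is
not advanced; T7. Credit: -w2 g5 (the whole proof), -w4 g8 (split-prime Kummer witness), -w3 (Chebotarev–Kummer supply).
References (locators only): [cite: GrossLMS1991, §3, §9] [cite: Cox2013, §7.D, Thm. 8.12, §9.A] [cite: Serre1972, §2.4].
-/

noncomputable section

set_option autoImplicit false
set_option linter.dupNamespace false -- `Summit.BirchSwinnertonDyer.BirchSwinnertonDyer` (summit = problem), tree-wide

open scoped Classical NumberField Pointwise nonZeroDivisors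
open WeierstrassCurve NumberField Field IsDedekindDomain
open Literature.NumberTheory.GaloisRepresentations Literature.NumberTheory.EllipticCurves
open Literature.NumberTheory.NumberFields.RingClassField Literature.NumberTheory.QuadraticFields

namespace Summit.BirchSwinnertonDyer.BirchSwinnertonDyer.Theorems.AuxPrimeSupplyCorner

open Summit.BirchSwinnertonDyer.BirchSwinnertonDyer.Theorems.AuxPrimeSupply

/-- **THE AUXILIARY-PRIME SUPPLY AT A NON-SURJECTIVE IRREDUCIBLE IMAGE, MODULO THE PRE-WITNESS (L1).** = -w2 g5's `AuxPrimeSupply.auxiliaryPrimeSupply`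
(p645521) with `ρ̄_{E,p}` onto replaced by «`E[p]` irreducible, `ρ̄` NOT onto, and the Frobenius pre-witness `hpre` at every level `p^E`»: the Kummer
exclusion is DISCHARGED on the corner (`AuxPrimeSupplyCorner.kummerExclusion_of_irr_of_not_surj`, this seat: images of order prime to `p`), the
Chebotarev step, the split-prime Kummer witness and the ring-class order computation are image-free and VERBATIM. So r22's slot 6″
(`stub_cornerAuxPrimeSupply57`) reduces to the PRE-WITNESS ALONE: `∃ γ ∉ res Γ_K, γ ζ_{p^E} = ζ_{p^E}⁻¹, tr ρ̄_{E,p}(γ) ≠ 0` — pure Galois∕group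
theory on lane B's exact corner images (N(C_s) at 5, 7; Zywina's G₉ at 5; memo CORNER-G18 §5′: γ = c₀·[a,b] off the «imaginary Cartan field» branch,
where the frame's `p` inert ∧ `p ∤ d_K` is needed). CONDITIONAL on `hpre`; nothing booked.
[cite: GrossLMS1991, §3 (p. 239), §9] [cite: Cox2013, §7.D (7.27), Thm. 8.12, §9.A] [cite: Serre1972, §2.4 Prop. 15] -/
theorem auxiliaryPrimeSupply_of_preWitness (W : WeierstrassCurve ℚ) [W.IsElliptic] [W.IsGloballyMinimal]
    (K : Type) [Field K] [NumberField K] (hK : IsImaginaryQuadratic K)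
    (hdK : NumberField.discr K < -4) (p : ℕ) [Fact p.Prime] (hp5 : 5 ≤ p)
    (hirr : W.HasIrreducibleModPGaloisRep p) (hns : ¬ W.HasSurjectiveModNGaloisRep p)
    -- (L1) the Frobenius PRE-WITNESS at every `p`-power level: an element outside `res Γ_K` inverting `ζ_{p^E}` with non-zero trace on `E[p]`
    (hpre : ∀ {E : ℕ}, 1 ≤ E → ∀ {ζ : AlgebraicClosure ℚ}, IsPrimitiveRoot ζ (p ^ E) →
      ∃ γ : absoluteGaloisGroup ℚ, γ ∉ (absGaloisRestrict ℚ K).range ∧ γ • ζ = ζ⁻¹ ∧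
        letI : Module (ZMod p) (geomTorsion W p) := AddSubgroup.torsionBy.zmodModule
        LinearMap.trace (ZMod p) (geomTorsion W p)
          ((galoisRepTorsion W p γ).toAdd.toAddMonoidHom.toZModLinearMap p) ≠ 0)
    (q : ℕ) [Fact q.Prime]
    (hq2 : ((Ideal.span {(q : ℤ)}).primesOver (𝓞 K)).ncard = 2) (N : ℕ) (hN : N ≠ 0) :
    ∀ (E : ℕ) (T : Finset ℕ), ∃ ℓ₀ : ℕ, ℓ₀.Prime ∧ ℓ₀ ∉ T ∧ ¬ ℓ₀ ∣ N ∧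
      (Ideal.span {(ℓ₀ : 𝓞 K)}).IsPrime ∧ ¬ (p : ℤ) ∣ W.frobeniusTrace ℓ₀ ∧
      ∀ v : HeightOneSpectrum (𝓞 K), ((q : ℕ) : 𝓞 K) ∈ v.asIdeal →
        p ^ E ∣ orderOf (primeClass ℓ₀ v) := by
  classical
  intro E T
  have hp : p.Prime := Fact.out
  have hq : q.Prime := Fact.out
  have hK2 := hK.1
  haveI : Algebra.IsQuadraticExtension ℚ K := ⟨hK2⟩
  -- work at the exponent `E' = max E 1 ≥ 1`
  set E' := max E 1 with hE'
  have hE'1 : 1 ≤ E' := le_max_right _ _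
  have hEE' : p ^ E ∣ p ^ E' := pow_dvd_pow p (le_max_left _ _)
  haveI : NeZero (p ^ E') := ⟨pow_ne_zero _ hp.ne_zero⟩
  -- a primitive `p^E'`-th root of unity, the embedding `e`, the split primes, `β`
  obtain ⟨ζ, hζ⟩ := HasEnoughRootsOfUnity.exists_primitiveRoot (AlgebraicClosure ℚ) (p ^ E')
  obtain ⟨e, he⟩ := exists_mem_range_absGaloisRestrict_iff ℚ K
  obtain ⟨τ, v₁, v₂, hτ, hv12, hv₂, hfac, hqv₁, hall⟩ := exists_split_primes hK2 hq hq2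
  set c₁ := ClassGroup.mk0 ⟨v₁.asIdeal, mem_nonZeroDivisors_iff_ne_zero.mpr v₁.ne_bot⟩ with hc₁
  set h := orderOf c₁ with hh
  have hh0 : 0 < h := orderOf_pos c₁
  have hord : ∀ n : ℕ, c₁ ^ n = 1 → h ∣ n := fun n hn ↦ orderOf_dvd_of_pow_eq_one hn
  obtain ⟨β, hβ⟩ : ∃ β : 𝓞 K, v₁.asIdeal ^ h = Ideal.span {β} := by
    have hmk : (⟨v₁.asIdeal, mem_nonZeroDivisors_iff_ne_zero.mpr v₁.ne_bot⟩ : (Ideal (𝓞 K))⁰) ^ h =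
        ⟨v₁.asIdeal ^ h, mem_nonZeroDivisors_iff_ne_zero.mpr (pow_ne_zero h v₁.ne_bot)⟩ :=
      Subtype.ext (by rw [SubmonoidClass.coe_pow])
    have h1 : ClassGroup.mk0 ⟨v₁.asIdeal ^ h,
        mem_nonZeroDivisors_iff_ne_zero.mpr (pow_ne_zero h v₁.ne_bot)⟩ = 1 := by
      rw [← hmk, map_pow]
      exact pow_orderOf_eq_one c₁
    obtain ⟨⟨β, hβ⟩⟩ := (ClassGroup.mk0_eq_one_iff _).mp h1
    exact ⟨β, hβ⟩
  have hβ0 : β ≠ 0 := by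
    intro h0
    refine pow_ne_zero h v₁.ne_bot ?_
    rw [hβ, h0]
    exact Ideal.span_singleton_eq_bot.mpr rfl
  -- the Frobenius witness
  obtain ⟨γ₀, hγ₀H, hγ₀ζ, hγ₀tr⟩ := hpre hE'1 hζ
  obtain ⟨α, hα⟩ := IsAlgClosed.exists_pow_nat_eq (e (β : K)) hp.pos
  have hα0 : α ≠ 0 := by
    intro h0
    have : e (β : K) = 0 := by rw [← hα, h0, zero_pow hp.ne_zero]
    rw [map_eq_zero_iff e e.injective, RingOfIntegers.coe_eq_zero_iff] at this
    exact hβ0 this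
  have hKEX := AuxPrimeSupplyCorner.kummerExclusion_of_irr_of_not_surj W hK2 hp5 hirr hns hE'1 hζ e he hγ₀H hq hv12 hfac hh0 hord hβ
  obtain ⟨γ, hγH, hγζ, hγtr, hγα⟩ :=
    exists_witness_of_kummerExclusion W hK hE'1 e hζ hα hα0 hγ₀H hγ₀ζ hγ₀tr hKEX
  -- the auxiliary prime, outside `T ∪ {q} ∪ primeFactors N`
  obtain ⟨ℓ₀, hℓ₀, hℓ₀T, hinert, hpE, haℓ, hkum⟩ :=
    exists_auxPrime_of_frobeniusWitness W hK hE'1 e hζ hα hγH hγζ hγtr hγα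
      (T ∪ {q} ∪ N.primeFactors)
  simp only [Finset.mem_union, Finset.mem_singleton, Nat.mem_primeFactors, not_or] at hℓ₀T
  obtain ⟨⟨hℓ₀T', hℓ₀q⟩, hℓ₀N⟩ := hℓ₀T
  have hℓ₀N' : ¬ ℓ₀ ∣ N := fun hd ↦ hℓ₀N ⟨hℓ₀, hd, hN⟩
  refine ⟨ℓ₀, hℓ₀, hℓ₀T', hℓ₀N', hinert, haℓ, fun v hv ↦ (hEE'.trans ?_)⟩
  -- `p ∤ ℓ₀ - 1` (as `p ∣ ℓ₀ + 1`, `p ≠ 2`)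
  have hpℓ : ¬ p ∣ ℓ₀ - 1 := by
    intro hd
    have h1 : p ∣ ℓ₀ + 1 := (dvd_pow_self p (by omega)).trans hpE
    have h2 : p ∣ (ℓ₀ + 1) - (ℓ₀ - 1) := Nat.dvd_sub h1 hd
    have h3 : (ℓ₀ + 1) - (ℓ₀ - 1) = 2 := by have := hℓ₀.one_le; omega
    rw [h3] at h2
    have := Nat.le_of_dvd two_pos h2
    omega
  -- at `𝔮 = v₁`
  have hv₁cop : v₁.asIdeal ⊔ Ideal.span {(ℓ₀ : 𝓞 K)} = ⊤ := by
    refine (sup_span_eq_top_iff_not_le ℓ₀).mpr ?_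
    intro hle
    have hmem : (ℓ₀ : 𝓞 K) ∈ v₁.asIdeal := hle (Ideal.mem_span_singleton_self _)
    have hcop : Nat.Coprime ℓ₀ q := (Nat.coprime_primes hℓ₀ hq).mpr hℓ₀q
    obtain ⟨a, b, hab⟩ : IsCoprime (ℓ₀ : ℤ) (q : ℤ) := Nat.isCoprime_iff_coprime.mpr hcop
    have h1 : ((a * ℓ₀ + b * q : ℤ) : 𝓞 K) ∈ v₁.asIdeal := by
      push_cast
      exact v₁.asIdeal.add_mem (v₁.asIdeal.mul_mem_left _ hmem) (v₁.asIdeal.mul_mem_left _ hqv₁)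
    rw [hab, Int.cast_one] at h1
    exact v₁.isPrime.ne_top ((Ideal.eq_top_iff_one _).mpr h1)
  have hdiv₁ : p ^ E' ∣ orderOf (primeClass ℓ₀ v₁) :=
    RingClass.pow_dvd_orderOf_primeClass_of_inert hK2 hdK hℓ₀ hinert hp hpE hpℓ hv₁cop hβ hkum
  rcases hall v hv with hv' | hv'
  · rw [hv']; exact hdiv₁
  · -- at `τ𝔮 = v₂`: `[v₁][v₂] = 1`, so the orders agree
    rw [hv']
    have hv₁' : ¬ Ideal.span {(ℓ₀ : 𝓞 K)} ≤ v₁.asIdeal := (sup_span_eq_top_iff_not_le ℓ₀).mp hv₁cop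
    have hmul := RingClass.primeClass_mul_primeClass_eq_one_of_smul hK2 τ hτ ℓ₀ hv₂ hv₁'
    have heq : primeClass ℓ₀ v₂ = (primeClass ℓ₀ v₁)⁻¹ := eq_inv_of_mul_eq_one_right hmul
    rw [heq, orderOf_inv]
    exact hdiv₁

end Summit.BirchSwinnertonDyer.BirchSwinnertonDyer.Theorems.AuxPrimeSupplyCorner

end
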